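import Summits.QuantumFields.BalabanUV.T4Continuum.Support.NE7SliceLetterBalabanGauge
import Summits.QuantumFields.BalabanUV.T4Continuum.Support.NE7TensionRadiusOfFluxGradient
import Summits.QuantumFields.BalabanUV.T4Continuum.Support.NE7FramePotCurvedL1
import HarnessLib

/-!
# NE7SliceLetterBalabanGaugeClass — F167 WITH THE TENSION LETTER AND THE `ℓ¹` FRAME LETTER DISCHARGED FROM THE CLASS DATA: the END's four-term letter
# ⟸ the ONE-TERM letter on Bałaban's straight slice (any gauge side condition) + the gauge-TRANSPORT letter + the flux-gradient radius of the background — nothing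
# else displayed (file 98 of the curved (APE), F168)

Cell `pub-balaban`, rung (B)+1 sub-cell t4, lineage `b2b-balaban-t4-ne7-p1` (CRUX PROVER NE7 #1 = OWNER of row NE7), generation 83; memo
`t4/b2b-balaban-t4-ne7-p1-g83/BALABAN-GAUGE-ROAD.md` §3, §6 (1)–(2).  Over F167 `NE7SliceLetterBalabanGauge.fourTermLetter_of_balabanSlice`, F141
`NE7TensionRadiusOfFluxGradient.abs_dAction_le_of_fluxGrad` (the integrated tension letter from the flux-gradient radius: `τ_W = d·g_W + 12·#Plane·x²`, `x ≤ 1∕4`) and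
F72 `NE7FramePotCurvedL1.sum_norm_framePotW_le_Kmaj` (the `ℓ¹` letter of the accumulated frames at EVERY background of the multi-level class, `k`-uniform constant
`C_fr = 2dL·exp((L^d∕L)·d·wlin-profile·2∕twoLevelSmall)`) BY NAME.
WHY.  F167 displayed four letters; two of them were already kernel facts of this lineage (gens 76, 81).  THIS file plugs them in, so that the END's one letter `h4`
(F152∕F165) now rests on EXACTLY TWO displayed letters: (KL-B) the one-term letter on Bałaban's slice-and-gauge (= the curl row of Bałaban's constrained propagator at
curved `W`, [B9] Thm 3.1–3.3∕(3.49)∕3.11 TYPE — NE9's rows, memo §4) and (KL-T) the gauge-transport letter (scalar rows at scale `M`, memo §5) — plus the background's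
flux-gradient radius `g_W` (row NE3's `RegularSup` datum, already a binder of the END).
WHAT ([folklore]; 0 def, 0 sorry).  **`fourTermLetter_of_balabanSlice_class`** (`d ≥ 2`, `L ≥ 2`, `x ≤ 1∕4`): the four-term letter with `K_G = K_B(1 + 2dC_fr)`,
`K_X = 2dK_BC_frτ_W + A·C_R`, `K_D = A·C_D`, `K_Ξ = A·C_Ξ`, `A = 2K_Bτ_W(1 + 4dC_fr) + 2x`, `τ_W`, `C_fr` as above, spelled out.
HONEST FRAMING (page 1): composition; (KL-B) and (KL-T) are DISPLAYED HYPOTHESES (not proved); nothing of Bałaban's asserted; (APE) on curved data NOT proved; NOT ONE-STEP,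
NOT NE7; spine 0∕9; finite T⁴ rung (B)+1 — NOT infinite volume, NOT mass gap, NOT `BetaPertH`, NOT Clay.  Continuum YM on T⁴ ⇐ BetaPertH ∧ nine spine estimates (0/9
proved); BetaPertH ⇐ (D1) ∧ (D4) ∧ CAP+tail; G-an2-4 gates asym, D1 and NE2/3/4.
-/

set_option autoImplicit false

open scoped BigOperators Matrix Matrix.Norms.L2Operator
open NormedSpace Finset

namespace Summit.QuantumFields.BalabanUV.T4Continuum.NE7SliceLetterBalabanGaugeClass

open Literature.MathematicalPhysics.QuantumFieldTheory.Balaban1983to89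
open B7Prop1Explicit B7Prop2Explicit UnitaryModel
open T4AveragingDeficitWall (Ad IsUnitaryCfg IsSkewDir SmallField curlAt dirL1 flux covGrad)
open T4AveragingDeficitWallBoundary (IsPeriodicCfg periodBox)
open AveragingDeficitPeriodicCounting (IsPeriodicDir)
open AveragingDeficitTwoLevelPrep (twoLevelSmall)
open AveragingDeficitMultiLevelPrep (LevelSmall)
open MinimalActionLevels (perWin)
open BlockAverageVaryHolo (nbRad)
open BlockAveragePushDirGauge (gaugeDir)
open NE3HessForm (hess dAction)
open NE3TangentCovariantTower (dirIter QbarIter)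
open NE3CovariantWeitzenbock (covDiv)
open NE7SliceLetterBalabanGauge (fourTermLetter_of_balabanSlice)
open NE7TensionRadiusOfFluxGradient (abs_dAction_le_of_fluxGrad)
open NE7FramePotCurvedL1 (sum_norm_framePotW_le_Kmaj)

noncomputable section

variable {d : ℕ} {n : Type*} [Fintype n] [DecidableEq n]

/-- **THE END's FOUR-TERM LETTER FROM (KL-B) + (KL-T) + THE FLUX-GRADIENT RADIUS.**  As F167 `fourTermLetter_of_balabanSlice`, with the tension letter supplied by
F141 (`τ_W = d·g_W + 12·#Plane·x²` from `‖covGrad W (flux W)‖ ≤ g_W`, `x ≤ 1∕4`; the antisymmetric table of `flux W` built here) and the `ℓ¹` frame letter by F72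
(`C_fr = 2dL·exp(…)`, every background of the class, every periodic test).  Displayed: `Gauge` (any side condition), (KL-B) `hB`, (KL-T) `hT`. [folklore] -/
theorem fourTermLetter_of_balabanSlice_class [Nonempty n] (hd : 2 ≤ d) {L N : ℕ} [NeZero N] (hL : 2 ≤ L) (j : ℕ)
    {W : Site d → Fin d → (Matrix n n ℂ)ˣ} {x : ℝ} (hWu : IsUnitaryCfg W) (hWP : IsPeriodicCfg W ((N * L ^ (j + 1) : ℕ) : ℤ))
    (hx : 0 ≤ x) (hx4 : x ≤ 1 / 4) (hs : LevelSmall d L j x) (hWx : SmallField W x)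
    -- the flux-gradient radius of the background (row NE3's `RegularSup` datum)
    {gW : ℝ} (hgW : ∀ (z : Site d) (μ : Fin d) (π : T4AveragingDeficitWall.Plane d), ‖covGrad W (flux W) z μ π‖ ≤ gW)
    -- (KL-B): the one-term letter on Bałaban's slice, with an arbitrary gauge side condition
    (Gauge : (Site d → Fin d → Matrix n n ℂ) → Prop) {KB : ℝ}
    (hB : ∀ X'' : Site d → Fin d → Matrix n n ℂ, IsSkewDir X'' → IsPeriodicDir X'' ((N * L ^ (j + 1) : ℕ) : ℤ) → QbarIter L (j + 1) W X'' = 0 → Gauge X'' →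
      ∀ g'' : ℝ, 0 ≤ g'' →
      (∀ Y : Site d → Fin d → Matrix n n ℂ, IsSkewDir Y → IsPeriodicDir Y ((N * L ^ (j + 1) : ℕ) : ℤ) → QbarIter L (j + 1) W Y = 0 →
        |hess W X'' Y (perWin d (N * L ^ (j + 1)))| ≤ g'' * dirL1 Y (periodBox (d := d) (N * L ^ (j + 1)))) →
      ∀ z μ' ν', μ' ≠ ν' → ‖curlAt W X'' z μ' ν'‖ ≤ KB * g'')
    -- (KL-T): the transport letter
    {CR CΞ CD : ℝ}
    (hT : ∀ X : Site d → Fin d → Matrix n n ℂ, IsSkewDir X → IsPeriodicDir X ((N * L ^ (j + 1) : ℕ) : ℤ) → dirIter L (j + 1) W X = 0 →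
      ∀ σ : Site d → Matrix n n ℂ, (∀ y, σ y ∈ skewAdjoint (Matrix n n ℂ)) → (∀ (y : Site d) (i : Fin d), σ (y + ((N * L ^ (j + 1) : ℕ) : ℤ) • e i) = σ y) →
      ∀ R : ℝ, (∀ y κ', ‖X y κ'‖ ≤ R) → ∀ Ξ : ℝ, (∀ y, ‖σ y‖ ≤ Ξ) →
      ∀ D : ℝ, (∀ y, ‖covDiv W (fun z κ => X z κ + gaugeDir W σ z κ) y‖ ≤ D) →
      ∃ lam : Site d → Matrix n n ℂ, (∀ y, lam y ∈ skewAdjoint (Matrix n n ℂ)) ∧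
        (∀ (y : Site d) (i : Fin d), lam (y + ((N * L ^ (j + 1) : ℕ) : ℤ) • e i) = lam y) ∧
        QbarIter L (j + 1) W (fun y κ => X y κ + gaugeDir W lam y κ) = 0 ∧ Gauge (fun y κ => X y κ + gaugeDir W lam y κ) ∧
        ∀ y, ‖lam y‖ ≤ CR * R + CΞ * Ξ + CD * D) :
    ∀ X : Site d → Fin d → Matrix n n ℂ, IsSkewDir X →
      IsPeriodicDir X ((N * L ^ (j + 1) : ℕ) : ℤ) → dirIter L (j + 1) W X = 0 → ∀ R : ℝ, (∀ y κ', ‖X y κ'‖ ≤ R) → ∀ g : ℝ, 0 ≤ g →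
      (∀ Y : Site d → Fin d → Matrix n n ℂ, IsSkewDir Y → IsPeriodicDir Y ((N * L ^ (j + 1) : ℕ) : ℤ) → dirIter L (j + 1) W Y = 0 →
        |hess W X Y (perWin d (N * L ^ (j + 1)))| ≤ g * dirL1 Y (periodBox (d := d) (N * L ^ (j + 1)))) →
      ∀ σ : Site d → Matrix n n ℂ, (∀ y, σ y ∈ skewAdjoint (Matrix n n ℂ)) →
      (∀ (y : Site d) (i : Fin d), σ (y + ((N * L ^ (j + 1) : ℕ) : ℤ) • e i) = σ y) → ∀ Ξ : ℝ, (∀ y, ‖σ y‖ ≤ Ξ) →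
      ∀ D : ℝ, (∀ y, ‖covDiv W (fun z κ => X z κ + gaugeDir W σ z κ) y‖ ≤ D) →
      ∀ z μ' ν', μ' ≠ ν' → ‖curlAt W X z μ' ν'‖
        ≤ (KB * (1 + 2 * d * (2 * ((d : ℝ) * L) * Real.exp (((L : ℝ) ^ d / L) * ((d : ℝ) * (16 * ((d : ℝ) + 1) * ((d : ℝ) + 4) * (L : ℝ) ^ 2)
            * (1250 * ((nbRad d L : ℝ) + L) + 8 * ((d : ℝ) * L) + 2 * L)) * (2 / twoLevelSmall d L))))) * g
          + (2 * d * KB * (2 * ((d : ℝ) * L) * Real.exp (((L : ℝ) ^ d / L) * ((d : ℝ) * (16 * ((d : ℝ) + 1) * ((d : ℝ) + 4) * (L : ℝ) ^ 2)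
            * (1250 * ((nbRad d L : ℝ) + L) + 8 * ((d : ℝ) * L) + 2 * L)) * (2 / twoLevelSmall d L))) * ((d : ℝ) * gW + 12 * (Fintype.card (T4AveragingDeficitWall.Plane d) : ℝ) * x ^ 2)
              + (2 * KB * ((d : ℝ) * gW + 12 * (Fintype.card (T4AveragingDeficitWall.Plane d) : ℝ) * x ^ 2) * (1 + 4 * d * (2 * ((d : ℝ) * L) * Real.exp (((L : ℝ) ^ d / L) * ((d : ℝ) * (16 * ((d : ℝ) + 1) * ((d : ℝ) + 4) * (L : ℝ) ^ 2)
            * (1250 * ((nbRad d L : ℝ) + L) + 8 * ((d : ℝ) * L) + 2 * L)) * (2 / twoLevelSmall d L)))) + 2 * x) * CR) * R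
          + ((2 * KB * ((d : ℝ) * gW + 12 * (Fintype.card (T4AveragingDeficitWall.Plane d) : ℝ) * x ^ 2) * (1 + 4 * d * (2 * ((d : ℝ) * L) * Real.exp (((L : ℝ) ^ d / L) * ((d : ℝ) * (16 * ((d : ℝ) + 1) * ((d : ℝ) + 4) * (L : ℝ) ^ 2)
            * (1250 * ((nbRad d L : ℝ) + L) + 8 * ((d : ℝ) * L) + 2 * L)) * (2 / twoLevelSmall d L)))) + 2 * x) * CD) * D
          + ((2 * KB * ((d : ℝ) * gW + 12 * (Fintype.card (T4AveragingDeficitWall.Plane d) : ℝ) * x ^ 2) * (1 + 4 * d * (2 * ((d : ℝ) * L) * Real.exp (((L : ℝ) ^ d / L) * ((d : ℝ) * (16 * ((d : ℝ) + 1) * ((d : ℝ) + 4) * (L : ℝ) ^ 2)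
            * (1250 * ((nbRad d L : ℝ) + L) + 8 * ((d : ℝ) * L) + 2 * L)) * (2 / twoLevelSmall d L)))) + 2 * x) * CΞ) * Ξ := by
  have hd1 : 1 ≤ d := by omega
  have hL1 : 1 ≤ L := by omega
  have hN1 : 1 ≤ N := Nat.one_le_iff_ne_zero.mpr (NeZero.ne N)
  have hP : 2 ≤ N * L ^ (j + 1) := by
    have hM2 : 2 ≤ L ^ (j + 1) := le_trans hL (Nat.le_self_pow (by omega) L)
    calc 2 ≤ 1 * L ^ (j + 1) := by omega
      _ ≤ N * L ^ (j + 1) := Nat.mul_le_mul_right _ hN1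
  have hP1 : 1 ≤ N * L ^ (j + 1) := by omega
  have hgW0 : 0 ≤ gW := (norm_nonneg _).trans (hgW 0 ⟨0, by omega⟩ ⟨(⟨0, by omega⟩, ⟨1, by omega⟩), by simp⟩)
  -- the antisymmetric table of `flux W` (F141's `B`)
  have hBF : ∀ (y : Site d) (μ ν : Fin d) (h : μ < ν),
      (fun (y : Site d) (μ ν : Fin d) => if h : μ < ν then flux W (y, ⟨(μ, ν), h⟩) else if h' : ν < μ then -flux W (y, ⟨(ν, μ), h'⟩) else 0) y μ ν
        = flux W (y, ⟨(μ, ν), h⟩) := fun y μ ν h => by simp only [dif_pos h]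
  have hanti : ∀ (y : Site d) (μ ν : Fin d),
      (fun (y : Site d) (μ ν : Fin d) => if h : μ < ν then flux W (y, ⟨(μ, ν), h⟩) else if h' : ν < μ then -flux W (y, ⟨(ν, μ), h'⟩) else 0) y ν μ
        = -(fun (y : Site d) (μ ν : Fin d) => if h : μ < ν then flux W (y, ⟨(μ, ν), h⟩) else if h' : ν < μ then -flux W (y, ⟨(ν, μ), h'⟩) else 0) y μ ν := by
    intro y μ ν
    rcases lt_trichotomy μ ν with h | h | h
    · simp only [dif_neg (not_lt.mpr h.le), dif_pos h]
    · subst h; simp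
    · simp only [dif_pos h, dif_neg (not_lt.mpr h.le), neg_neg]
  have hτ0 : 0 ≤ ((d : ℝ) * gW + 12 * (Fintype.card (T4AveragingDeficitWall.Plane d) : ℝ) * x ^ 2) := by positivity
  have htsl : 0 < twoLevelSmall d L := by unfold AveragingDeficitTwoLevelPrep.twoLevelSmall; positivity
  have hCfr0 : 0 ≤ (2 * ((d : ℝ) * L) * Real.exp (((L : ℝ) ^ d / L) * ((d : ℝ) * (16 * ((d : ℝ) + 1) * ((d : ℝ) + 4) * (L : ℝ) ^ 2)
            * (1250 * ((nbRad d L : ℝ) + L) + 8 * ((d : ℝ) * L) + 2 * L)) * (2 / twoLevelSmall d L))) := by positivity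
  exact fourTermLetter_of_balabanSlice hL1 j hP hWu hWP hx hs hWx hτ0
    (fun K hK hKP => abs_dAction_le_of_fluxGrad hP1 hWu hWP hx hx4 hWx hBF hanti hgW0 hgW hK hKP) hCfr0
    (fun Y _ hYP _ => sum_norm_framePotW_le_Kmaj hd hL j hWu hx hs hWx hYP) Gauge hB hT

end

end Summit.QuantumFields.BalabanUV.T4Continuum.NE7SliceLetterBalabanGaugeClass
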